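import Literature.AlgebraicGeometry.Resolution.GenericFibreResolutionDatum
import Literature.AlgebraicGeometry.Resolution.SaturatedIdealSheaf
import Literature.AlgebraicGeometry.Resolution.SmoothGenericFibreSpread
import Literature.AlgebraicGeometry.Resolution.SmoothOfRegularPerfectField
import Literature.AlgebraicGeometry.Resolution.ResolutionOfIsoLocus
import Literature.AlgebraicGeometry.Resolution.IsoLocusOfClosure
import Literature.AlgebraicGeometry.Resolution.BaseChangeOverOpens
import Mathlib.RingTheory.MvPolynomial.Localization
import Mathlib.RingTheory.TensorProduct.MvPolynomial
import Mathlib.CategoryTheory.Limits.Shapes.Pullback.Pasting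
import Mathlib.FieldTheory.Perfect
import HarnessLib

/-!
# Spreading out a resolution from the generic fibre: the model over the base (prime case)

Topic: `Literature/AlgebraicGeometry/Resolution`. The heart of the proof of
`BierstoneGrigorievMilmanWlodarczyk2011` (`EffectiveResolution.lean`; BGMW 2011, Cor. 8.0.6 in
the weak non-embedded form: resolution of integral `V(S) ⊆ 𝔸ⁿ_k` for `char k = p ≫ 0`) from
resolution of marked ideals in characteristic zero, by SPREADING OUT (EGA IV₃ §8 technique, here
made elementary). Setting: `A` a Noetherian domain with fraction field `K` of characteristic
zero, `R = A[x₁, …, xₙ]`, `ψ : R → K[x]`, a PRIME ideal `rad ⊆ K[x]` (the radical of the generic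
member of a family) with generators `S'`, such that the marked ideal `(𝔸ⁿ_K, 𝓘_{V(S')}, ∅, 1)`
has a resolution. Put `J = ψ⁻¹(rad)` and `T = Spec (R ⧸ J) → Spec A` (the closure of `V(rad)` in
`𝔸ⁿ_A`).

**Theorem** (`exists_forall_hasResolution_pullback`). There is `a ≠ 0` in `A` such that for
every field-valued point `A → k` with `a ↦ a' ≠ 0` at which the fibre `T_k = T ×_A Spec k` is
integral, `T_k` has a resolution of singularities (`Scheme.HasResolution`).

Construction (classical; Kollár 2007 §3.3-style use of the strict transform, EGA IV 8/9/17
spreading): the char-0 datum (`exists_blowup_regular_closure`, `GenericFibreResolutionDatum.lean`)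
gives `Q ⊆ K[x]` and `t ∈ Q ∖ rad` such that for every blow-up `p` of `𝔸ⁿ_K` along `Q` the reduced
closure of `p⁻¹(V(rad) ∩ D(t))` is regular. Over `A`: `Q_A = ψ⁻¹ Q`, `t_A ∈ R` with
`ψ t_A = t · (unit)`, `P_A = Bl_{Q_A} 𝔸ⁿ_A` (`affineBlowup`), and the closed subscheme
`Y'_A = V(C_A)`, `C_A = sat_{t_A}(J · 𝒪_{P_A})` (`satIdealSheaf`, `SaturatedIdealSheaf.lean`), the
scheme-theoretic closure of `p_A⁻¹(T ∩ D(t_A))`. Then: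
(i) the generic fibre `P_A ×_A K → 𝔸ⁿ_K` is a blow-up along `Q` (blow-ups commute with flat base
change, `IsBlowup.pullback_snd_of_flat`), and `C_A` pulls back to the corresponding saturation
(`comap_satIdealSheaf_of_flat`), which is the reduced closure of the datum
(`satIdealSheaf_eq_vanishingIdeal`): so `Y'_A ×_A K` is regular, hence smooth over `K`
(`smooth_of_isRegular_of_perfectField`), and `Y'_A → Spec A` is smooth over some `D(b₁)`
(`exists_forall_mem_smoothLocus_of_smooth_generic`), so its fibres there are regular;
(ii) `π_A : Y'_A → T` (the lift of `Y'_A → 𝔸ⁿ_A`) is proper and an isomorphism over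
`T ∩ D(t_A)` (`isIso_morphismRestrict_lift`), properties inherited by its fibres;
(iii) `t_A ⊗ 1` is not nilpotent in `(R ⧸ J) ⊗_A k` for `k`-points of some `D(b₂)`
(`exists_forall_not_isNilpotent_tmul_one`), so `T_k ∩ D(t_A)` is a non-empty, hence dense, open
of the integral `T_k`;
(iv) a proper morphism from a regular scheme which is an isomorphism over a dense open yields a
resolution (`hasResolution_of_isIso_morphismRestrict`).

## Sources

* E. Bierstone, D. Grigoriev, P. Milman, J. Włodarczyk, arXiv:1206.3090, Cor. 8.0.6 (numbering
  as in `EffectiveResolution.lean`). [BierstoneGrigorievMilmanWlodarczyk2011]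
* A. Grothendieck, EGA IV₃ §8, IV₄ 17.7 (spreading out); J. Kollár, *Lectures on Resolution of
  Singularities* (2007), §3.3. [folklore]
-/

noncomputable section

open CategoryTheory CategoryTheory.Limits AlgebraicGeometry TopologicalSpace MvPolynomial
  TensorProduct

namespace Literature.AlgebraicGeometry.Resolution

open Scheme.IdealSheafData

attribute [local instance] MvPolynomial.algebraMvPolynomial

/-! ## Small lemmas -/

/-- The ideal sheaf of a radical ideal is a radical ideal sheaf. [folklore] -/
theorem radical_idealSheaf_of_isRadical {R : Type} [CommRing R] (I : Ideal R) (hI : I.IsRadical) :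
    (affineBlowup.idealSheaf I).radical = affineBlowup.idealSheaf I := by
  refine le_antisymm (le_of_isAffine ?_) (le_radical _)
  rw [radical_ideal, affineBlowup.idealSheaf_ideal_top]
  have hsurj : Function.Surjective (Scheme.ΓSpecIso (.of R)).inv.hom :=
    (Scheme.ΓSpecIso (.of R)).commRingCatIsoToRingEquiv.symm.surjective
  have hinj : Function.Injective (Scheme.ΓSpecIso (.of R)).inv.hom :=
    (Scheme.ΓSpecIso (.of R)).commRingCatIsoToRingEquiv.symm.injective
  have hker : RingHom.ker (Scheme.ΓSpecIso (.of R)).inv.hom ≤ I := by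
    rw [(RingHom.injective_iff_ker_eq_bot _).mp hinj]
    exact bot_le
  rw [← Ideal.map_radical_of_surjective hsurj hker, hI.radical]

/-- The basic open of a global function on `Spec R` pulls back along `p` to the basic open of
its pull-back. [folklore] -/
theorem preimage_basicOpen_eq {R : Type} [CommRing R] {P : Scheme.{0}} (p : P ⟶ Spec (.of R))
    (r : R) : p ⁻¹ᵁ (PrimeSpectrum.basicOpen r) =
      P.basicOpen (p.appTop ((Scheme.ΓSpecIso (.of R)).inv r)) := by
  rw [← Scheme.preimage_basicOpen_top, basicOpen_eq_of_affine]

/-- An open non-empty subset of an irreducible scheme is dense. [folklore] -/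
theorem dense_of_isOpen_of_nonempty {X : Scheme.{0}} [IrreducibleSpace X] (U : X.Opens)
    (hU : (U : Set X).Nonempty) : Dense (U : Set X) :=
  U.isOpen.dense hU

/-! ## The setting -/

section Base

variable {A : Type} [CommRing A] (K : Type) [Field K] [Algebra A K] [IsFractionRing A K] {n : ℕ}

/-- `K[x]` is the localization of `A[x]` at the non-zero constants. [folklore] -/
theorem isLocalization_mvPolynomial :
    IsLocalization ((nonZeroDivisors A).map (C : A →+* MvPolynomial (Fin n) A))
      (MvPolynomial (Fin n) K) :=
  MvPolynomial.isLocalization (nonZeroDivisors A) K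

/-- Non-zero constants of `A` are units in `K[x]`. [folklore] -/
theorem isUnit_algebraMap_C {a : A} (ha : a ≠ 0) :
    IsUnit (algebraMap (MvPolynomial (Fin n) A) (MvPolynomial (Fin n) K) (C a)) := by
  rw [MvPolynomial.algebraMap_def, MvPolynomial.map_C]
  refine (isUnit_iff_ne_zero.mpr ?_).map C
  exact fun h => ha ((map_eq_zero_iff _ (IsFractionRing.injective A K)).mp h)

/-- A proper ideal of `K[x]` contains no non-zero constant of `A`; hence `A → A[x] ⧸ ψ⁻¹ 𝔞` is
injective. [folklore] -/
theorem comap_algebraMap_comap_eq_bot {𝔞 : Ideal (MvPolynomial (Fin n) K)} (h𝔞 : 𝔞 ≠ ⊤) :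
    RingHom.ker (algebraMap A (MvPolynomial (Fin n) A ⧸
      𝔞.comap (algebraMap (MvPolynomial (Fin n) A) (MvPolynomial (Fin n) K)))) = ⊥ := by
  rw [eq_bot_iff]
  intro a ha
  rw [RingHom.mem_ker, IsScalarTower.algebraMap_apply A (MvPolynomial (Fin n) A),
    Ideal.Quotient.algebraMap_eq, Ideal.Quotient.eq_zero_iff_mem, Ideal.mem_comap,
    MvPolynomial.algebraMap_eq] at ha
  by_contra ha0
  exact h𝔞 (Ideal.eq_top_of_isUnit_mem _ ha (isUnit_algebraMap_C K ha0))

end Base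

section Model

variable {A : Type} [CommRing A] [IsDomain A] [IsNoetherianRing A] (K : Type) [Field K]
  [CharZero K] [Algebra A K] [IsFractionRing A K] {n : ℕ}

/-- **The model theorem (prime case).** See the module docstring.
[cite: BierstoneGrigorievMilmanWlodarczyk2011, Cor. 8.0.6] -/
theorem exists_forall_hasResolution_pullback
    (rad : Ideal (MvPolynomial (Fin n) K)) [hprime : rad.IsPrime]
    (S' : Finset (MvPolynomial (Fin n) K))
    (hS' : Ideal.span (S' : Set (MvPolynomial (Fin n) K)) = rad)
    (hres : HasMarkedResolution K n S') :
    ∃ a : A, a ≠ 0 ∧ ∀ (k : Type) [Field k] [Algebra A k], algebraMap A k a ≠ 0 →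
      IsIntegral (pullback
        (Spec.map (CommRingCat.ofHom (algebraMap A (MvPolynomial (Fin n) A ⧸
          rad.comap (algebraMap (MvPolynomial (Fin n) A) (MvPolynomial (Fin n) K))))))
        (Spec.map (CommRingCat.ofHom (algebraMap A k)))) →
      Scheme.HasResolution (pullback
        (Spec.map (CommRingCat.ofHom (algebraMap A (MvPolynomial (Fin n) A ⧸
          rad.comap (algebraMap (MvPolynomial (Fin n) A) (MvPolynomial (Fin n) K))))))
        (Spec.map (CommRingCat.ofHom (algebraMap A k)))) := by
  classical
  -- Notation
  haveI := isLocalization_mvPolynomial (A := A) K (n := n)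
  set ψ : MvPolynomial (Fin n) A →+* MvPolynomial (Fin n) K :=
    algebraMap (MvPolynomial (Fin n) A) (MvPolynomial (Fin n) K) with hψdef
  set J : Ideal (MvPolynomial (Fin n) A) := rad.comap ψ with hJdef
  haveI hJprime : J.IsPrime := Ideal.comap_isPrime ψ rad
  have hradtop : rad ≠ ⊤ := hprime.ne_top
  -- ### Step 1: the char-0 datum, with `t` rescaled into `ψ((MvPolynomial (Fin n) A))`
  haveI : (Ideal.span (S' : Set (MvPolynomial (Fin n) K))).IsPrime := by rw [hS']; exact hprime
  obtain ⟨Q, t, htQ, htrad, hdat⟩ := exists_blowup_regular_closure S' inferInstance hres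
  rw [hS'] at htrad hdat
  obtain ⟨⟨tA, m⟩, htm⟩ := IsLocalization.surj ((nonZeroDivisors A).map (C : A →+* (MvPolynomial (Fin n) A))) t
  obtain ⟨a₀, ha₀, hm⟩ := m.2
  have ha₀' : (a₀ : A) ≠ 0 := nonZeroDivisors.ne_zero ha₀
  have hunit : IsUnit (ψ m) := by rw [← hm]; exact isUnit_algebraMap_C K ha₀'
  -- `ψ tA = t * unit`
  have htA : ψ tA = t * ψ m := htm.symm
  have htAQ : ψ tA ∈ Q := by rw [htA]; exact Ideal.mul_mem_right _ _ htQ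
  have htArad : ψ tA ∉ rad := by
    rw [htA]
    exact fun h => htrad ((Ideal.mul_unit_mem_iff_mem rad hunit).mp h)
  have hbasic_unit : PrimeSpectrum.basicOpen (ψ m) = (⊤ : Opens (PrimeSpectrum (MvPolynomial (Fin n) K))) :=
    top_le_iff.mp fun x _ hx => x.2.ne_top (Ideal.eq_top_of_isUnit_mem _ hx hunit)
  have hbasic : PrimeSpectrum.basicOpen (ψ tA) = PrimeSpectrum.basicOpen t := by
    rw [htA, PrimeSpectrum.basicOpen_mul, hbasic_unit, inf_top_eq]
  have htAJ : tA ∉ J := fun h => htArad (Ideal.mem_comap.mp h)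
  -- ### Step 2: the model over `A`
  set QA : Ideal (MvPolynomial (Fin n) A) := Q.comap ψ with hQAdef
  have hQAmap : QA.map ψ = Q := IsLocalization.map_under ((nonZeroDivisors A).map (C : A →+* (MvPolynomial (Fin n) A))) (MvPolynomial (Fin n) K) Q
  have hJmap : J.map ψ = rad := IsLocalization.map_under ((nonZeroDivisors A).map (C : A →+* (MvPolynomial (Fin n) A))) (MvPolynomial (Fin n) K) rad
  have htAQA : tA ∈ QA := Ideal.mem_comap.mpr htAQ
  -- the affine space, the blow-up `P_A`, its structure map
  let XA : Scheme.{0} := Spec (CommRingCat.of (MvPolynomial (Fin n) A))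
  let PA : Scheme.{0} := affineBlowup QA
  let pA : PA ⟶ XA := affineBlowup.π QA
  have hbl : IsBlowup pA (affineBlowup.idealSheaf QA) := affineBlowup.isBlowup QA
  haveI : IsProper pA := hbl.isProper
  -- the generic fibre `P_K = P_A ×_{𝔸ⁿ_A} 𝔸ⁿ_K`
  let XK : Scheme.{0} := Spec (CommRingCat.of (MvPolynomial (Fin n) K))
  let ι₀ : XK ⟶ XA := Spec.map (CommRingCat.ofHom ψ)
  haveI : Flat ι₀ := by
    change Flat (Spec.map (CommRingCat.ofHom (algebraMap (MvPolynomial (Fin n) A) (MvPolynomial (Fin n) K))))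
    rw [Flat.SpecMap_iff]
    exact RingHom.flat_algebraMap_iff.mpr
      (IsLocalization.flat (MvPolynomial (Fin n) K) ((nonZeroDivisors A).map (C : A →+* (MvPolynomial (Fin n) A))))
  haveI : IsAffineHom ι₀ := inferInstance
  let PK : Scheme.{0} := pullback pA ι₀
  let ι : PK ⟶ PA := pullback.fst pA ι₀
  let pK : PK ⟶ XK := pullback.snd pA ι₀
  haveI : IsAffineHom ι := MorphismProperty.pullback_fst _ _ inferInstance
  haveI : Flat ι := MorphismProperty.pullback_fst _ _ inferInstance
  have hsq : IsPullback ι pK pA ι₀ := IsPullback.of_hasPullback pA ι₀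
  have hblK : IsBlowup pK (affineBlowup.idealSheaf Q) := by
    have h := hbl.pullback_snd_of_flat ι₀
    rwa [affineBlowup.comap_idealSheaf_specMap, hQAmap] at h
  -- the datum on this model: the reduced closure of `p_K⁻¹(V(rad) ∩ D(t))` is regular
  have hregK := hdat PK pK hblK
  -- ### Step 3: the closed subscheme `Y'_A = V(C_A)` and its generic fibre
  let gA : Γ(XA, ⊤) := (Scheme.ΓSpecIso (.of (MvPolynomial (Fin n) A))).inv tA
  let gK : Γ(XK, ⊤) := (Scheme.ΓSpecIso (.of (MvPolynomial (Fin n) K))).inv (ψ tA)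
  have hgK : ι₀.appTop gA = gK := by
    change ((Scheme.ΓSpecIso (.of (MvPolynomial (Fin n) A))).inv ≫ (Spec.map (CommRingCat.ofHom ψ)).appTop) tA = _
    rw [← Scheme.ΓSpecIso_inv_naturality]
    rfl
  let MA : PA.IdealSheafData := (affineBlowup.idealSheaf J).comap pA
  let CA : PA.IdealSheafData := satIdealSheaf MA (pA.appTop gA)
  let MK : PK.IdealSheafData := (affineBlowup.idealSheaf rad).comap pK
  let CK : PK.IdealSheafData := satIdealSheaf MK (pK.appTop gK)
  have hMK : MA.comap ι = MK := by
    change ((affineBlowup.idealSheaf J).comap pA).comap ι = (affineBlowup.idealSheaf rad).comap pK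
    rw [← Scheme.IdealSheafData.comap_comp, hsq.w, Scheme.IdealSheafData.comap_comp,
      affineBlowup.comap_idealSheaf_specMap, hJmap]
  have hBC : CA.comap ι = CK := by
    change (satIdealSheaf MA (pA.appTop gA)).comap ι = satIdealSheaf MK (pK.appTop gK)
    rw [comap_satIdealSheaf_of_flat, hMK]
    congr 1
    rw [← hgK]
    change (pA.appTop ≫ ι.appTop) gA = (ι₀.appTop ≫ pK.appTop) gA
    rw [← Scheme.Hom.comp_appTop, ← Scheme.Hom.comp_appTop, hsq.w]
  -- `p_K` is an isomorphism over `D(ψ t_A) = D(t)`, which misses `V(Q)`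
  let DK : XK.Opens := PrimeSpectrum.basicOpen (ψ tA)
  have hWK : pK ⁻¹ᵁ DK = PK.basicOpen (pK.appTop gK) := preimage_basicOpen_eq pK (ψ tA)
  have hdisjK : Disjoint (DK : Set XK) (affineBlowup.idealSheaf Q).support := by
    rw [affineBlowup.support_idealSheaf]
    exact Set.disjoint_left.mpr fun x hx hxQ => (PrimeSpectrum.mem_basicOpen _ _).mp hx (hxQ htAQ)
  have hisoK : IsIso (pK ∣_ DK) := hblK.isIso_morphismRestrict hdisjK
  -- `M_K` is radical on `p_K⁻¹ D(t)`: it is pulled back from the radical `rad` along an open immersion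
  have hradsh : (affineBlowup.idealSheaf rad).radical = affineBlowup.idealSheaf rad :=
    radical_idealSheaf_of_isRadical rad hprime.isRadical
  have hradW : (MK.comap (pK ⁻¹ᵁ DK).ι).radical = MK.comap (pK ⁻¹ᵁ DK).ι := by
    change (((affineBlowup.idealSheaf rad).comap pK).comap _).radical = _
    rw [← Scheme.IdealSheafData.comap_comp, ← morphismRestrict_ι]
    haveI := hisoK
    exact radical_comap_of_isOpenImmersion _ hradsh _
  have hradV : ∀ V : PK.affineOpens, (V : PK.Opens) ≤ PK.basicOpen (pK.appTop gK) →
      (MK.ideal V).IsRadical := by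
    intro V hV
    refine isRadical_ideal_of_radical_comap_ι MK hradW V ?_
    rwa [hWK]
  -- hence `C_K` is the reduced closure of `p_K⁻¹(V(rad) ∩ D(t))`, regular by the datum
  have hsuppMK : ((MK.support : Closeds PK) : Set PK) =
      pK ⁻¹' (PrimeSpectrum.zeroLocus (rad : Set (MvPolynomial (Fin n) K))) := by
    change ((((affineBlowup.idealSheaf rad).comap pK).support : Closeds PK) : Set PK) = _
    rw [Scheme.IdealSheafData.support_comap, Closeds.coe_preimage, affineBlowup.support_idealSheaf]
  have hCKvan : CK = vanishingIdeal (⟨closure (pK ⁻¹'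
      (PrimeSpectrum.zeroLocus (rad : Set (MvPolynomial (Fin n) K)) ∩
        ((PrimeSpectrum.basicOpen t : Opens (PrimeSpectrum (MvPolynomial (Fin n) K))) : Set (PrimeSpectrum (MvPolynomial (Fin n) K))))),
      isClosed_closure⟩ : Closeds PK) := by
    change satIdealSheaf MK (pK.appTop gK) = _
    rw [satIdealSheaf_eq_vanishingIdeal MK (pK.appTop gK) hradV]
    congr 1
    ext1
    change closure (((MK.support : Closeds PK) : Set PK) ∩ (PK.basicOpen (pK.appTop gK) : Set PK)) =
      closure (pK ⁻¹' _)
    rw [hsuppMK, ← hWK, ← hbasic, Set.preimage_inter]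
    rfl
  have hregCK : Scheme.IsRegular CK.subscheme := by rw [hCKvan]; exact hregK
  -- ### Step 4: `Y'_A = V(C_A)`, its generic fibre `Y'_K`, smoothness
  let YA : Scheme.{0} := CA.subscheme
  let cι : YA ⟶ PA := CA.subschemeι
  have hregK' : Scheme.IsRegular (CA.comap ι).subscheme := by rw [hBC]; exact hregCK
  let YK : Scheme.{0} := pullback ι cι
  have hregYK : Scheme.IsRegular YK := hregK'.of_iso (CA.comapIso ι).hom
  -- structure maps and the cartesian squares down to `Spec A`
  let toA : XA ⟶ Spec (.of A) := Spec.map (CommRingCat.ofHom (algebraMap A (MvPolynomial (Fin n) A)))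
  let toK : XK ⟶ Spec (.of K) := Spec.map (CommRingCat.ofHom (algebraMap K (MvPolynomial (Fin n) K)))
  let sK : Spec (.of K) ⟶ Spec (.of A) := Spec.map (CommRingCat.ofHom (algebraMap A K))
  have hsqc : IsPullback toK ι₀ sK toA :=
    isPullback_SpecMap_of_isPushout _ _ _ _ (CommRingCat.isPushout_of_isPushout A K (MvPolynomial (Fin n) A) (MvPolynomial (Fin n) K))
  have hsqa : IsPullback (pullback.fst ι cι) (pullback.snd ι cι) ι cι := IsPullback.of_hasPullback ι cι
  have hbig : IsPullback (pullback.fst ι cι ≫ pK ≫ toK) (pullback.snd ι cι) sK (cι ≫ pA ≫ toA) := by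
    have h2 := (hsqa.paste_horiz hsq.flip).paste_horiz hsqc
    simpa only [Category.assoc] using h2
  let gYA : YA ⟶ Spec (.of A) := cι ≫ pA ≫ toA
  haveI : LocallyOfFiniteType toA := by
    rw [HasRingHomProperty.Spec_iff (P := @LocallyOfFiniteType)]
    exact RingHom.finiteType_algebraMap.mpr inferInstance
  haveI : LocallyOfFiniteType gYA := inferInstance
  haveI : QuasiCompact gYA := inferInstance
  haveI : LocallyOfFiniteType toK := by
    rw [HasRingHomProperty.Spec_iff (P := @LocallyOfFiniteType)]
    exact RingHom.finiteType_algebraMap.mpr inferInstance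
  haveI : PerfectField K := PerfectField.ofCharZero
  have hsmK : Smooth (pullback.fst ι cι ≫ pK ≫ toK) :=
    smooth_of_isRegular_of_perfectField _ hregYK
  have hsm : Smooth (pullback.snd gYA sK) := by
    have he : hbig.flip.isoPullback.hom ≫ pullback.snd gYA sK = pullback.fst ι cι ≫ pK ≫ toK :=
      hbig.flip.isoPullback_hom_snd
    have : pullback.snd gYA sK = hbig.flip.isoPullback.inv ≫ (pullback.fst ι cι ≫ pK ≫ toK) :=
      (Iso.eq_inv_comp _).mpr he
    rw [this]
    infer_instance
  -- `Y'_A` is Noetherian; smoothness spreads over some `D(b₁)`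
  haveI : IsLocallyNoetherian PA := LocallyOfFiniteType.isLocallyNoetherian pA
  haveI : CompactSpace PA := QuasiCompact.compactSpace_of_compactSpace pA
  haveI : IsLocallyNoetherian YA := LocallyOfFiniteType.isLocallyNoetherian cι
  haveI : CompactSpace YA := QuasiCompact.compactSpace_of_compactSpace cι
  haveI : IsNoetherian YA := {}
  obtain ⟨b₁, hb₁0, hb₁⟩ := exists_forall_mem_smoothLocus_of_smooth_generic K gYA hsm
  -- ### Step 5: `π_A : Y'_A → T = Spec ((MvPolynomial (Fin n) A) ⧸ J)`, proper, an isomorphism over `D(t_A)`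
  let TA : Scheme.{0} := Spec (CommRingCat.of ((MvPolynomial (Fin n) A) ⧸ J))
  let tιA : TA ⟶ XA := Spec.map (CommRingCat.ofHom (Ideal.Quotient.mk J))
  haveI : IsClosedImmersion tιA := IsClosedImmersion.spec_of_surjective _ Ideal.Quotient.mk_surjective
  have hkerT : tιA.ker = affineBlowup.idealSheaf J := ker_specMap_quotient_mk J
  have hleA : tιA.ker ≤ (cι ≫ pA).ker := by
    rw [hkerT]
    change affineBlowup.idealSheaf J ≤ CA.map pA
    rw [le_map_iff_comap_le]
    exact le_satIdealSheaf MA _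
  let πA : YA ⟶ TA := IsClosedImmersion.lift tιA (cι ≫ pA) hleA
  have hπA : πA ≫ tιA = cι ≫ pA := IsClosedImmersion.lift_fac _ _ _
  haveI : IsProper πA := by
    haveI : IsProper (πA ≫ tιA) := by rw [hπA]; infer_instance
    exact IsProper.of_comp πA tιA
  let DA : XA.Opens := PrimeSpectrum.basicOpen tA
  have hdisjA : Disjoint (DA : Set XA) (affineBlowup.idealSheaf QA).support := by
    rw [affineBlowup.support_idealSheaf]
    exact Set.disjoint_left.mpr fun x hx hxQ => (PrimeSpectrum.mem_basicOpen _ _).mp hx (hxQ htAQA)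
  have hisoA : IsIso (pA ∣_ DA) := hbl.isIso_morphismRestrict hdisjA
  have hWA : pA ⁻¹ᵁ DA = PA.basicOpen (pA.appTop gA) := preimage_basicOpen_eq pA tA
  have hCW : cι.ker.comap (pA ⁻¹ᵁ DA).ι = (tιA.ker.comap pA).comap (pA ⁻¹ᵁ DA).ι := by
    rw [ker_subschemeι, hkerT, hWA]
    exact comap_ι_satIdealSheaf MA (pA.appTop gA)
  have hisoπ : IsIso (πA ∣_ tιA ⁻¹ᵁ DA) :=
    isIso_morphismRestrict_lift pA tιA cι DA hleA hisoA hCW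
  -- compatibility with the structure maps to `Spec A`
  have htA' : Spec.map (CommRingCat.ofHom (algebraMap A ((MvPolynomial (Fin n) A) ⧸ J))) = tιA ≫ toA := by
    change Spec.map (CommRingCat.ofHom (algebraMap A ((MvPolynomial (Fin n) A) ⧸ J))) =
      Spec.map (CommRingCat.ofHom (Ideal.Quotient.mk J)) ≫ Spec.map (CommRingCat.ofHom (algebraMap A (MvPolynomial (Fin n) A)))
    rw [← Spec.map_comp, ← CommRingCat.ofHom_comp]
  have hg : πA ≫ Spec.map (CommRingCat.ofHom (algebraMap A ((MvPolynomial (Fin n) A) ⧸ J))) = gYA := by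
    rw [htA', ← Category.assoc, hπA, Category.assoc]
  -- ### Step 6: `t_A ⊗ 1` is not nilpotent in the fibres over some `D(b₂)`
  haveI : IsDomain ((MvPolynomial (Fin n) A) ⧸ J) := Ideal.Quotient.isDomain J
  obtain ⟨b₂, hb₂0, hb₂⟩ := exists_forall_not_isNilpotent_tmul_one (A := A) (B := (MvPolynomial (Fin n) A) ⧸ J)
    (Ideal.Quotient.mk J tA) ⟨⊥, Ideal.isPrime_bot, by
      rwa [Ideal.mem_bot, Ideal.Quotient.eq_zero_iff_mem], by
      rw [← RingHom.ker_eq_comap_bot]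
      exact comap_algebraMap_comap_eq_bot K hradtop⟩
  -- ### Step 7: the fibres
  refine ⟨b₁ * b₂, mul_ne_zero hb₁0 hb₂0, fun k _ _ ha hint => ?_⟩
  rw [map_mul] at ha
  have ha₁ := left_ne_zero_of_mul ha
  have ha₂ := right_ne_zero_of_mul ha
  let sφ : Spec (.of k) ⟶ Spec (.of A) := Spec.map (CommRingCat.ofHom (algebraMap A k))
  let tA' : TA ⟶ Spec (.of A) := Spec.map (CommRingCat.ofHom (algebraMap A ((MvPolynomial (Fin n) A) ⧸ J)))
  let Tφ : Scheme.{0} := pullback tA' sφ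
  let ψk : Tφ ⟶ TA := pullback.fst tA' sφ
  let ρ : pullback πA ψk ⟶ Tφ := pullback.snd πA ψk
  -- the source of `ρ` is regular (a fibre of the smooth `Y'_A|_{D(b₁)} → D(b₁)`)
  have hregφ : Scheme.IsRegular (pullback (πA ≫ tA') sφ) := by
    rw [hg]
    exact isRegular_pullback_of_forall_mem_smoothLocus gYA hb₁ (algebraMap A k) ha₁
  have hregρ : Scheme.IsRegular (pullback πA ψk) :=
    hregφ.of_iso (pullbackRightPullbackFstIso tA' sφ πA).inv
  -- … and locally Noetherian
  haveI : LocallyOfFiniteType tA' := by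
    change LocallyOfFiniteType (Spec.map (CommRingCat.ofHom (algebraMap A ((MvPolynomial (Fin n) A) ⧸ J))))
    rw [HasRingHomProperty.Spec_iff (P := @LocallyOfFiniteType)]
    exact RingHom.finiteType_algebraMap.mpr inferInstance
  haveI : IsLocallyNoetherian (pullback πA ψk) :=
    LocallyOfFiniteType.isLocallyNoetherian (ρ ≫ pullback.snd tA' sφ)
  -- `ρ` is proper and an isomorphism over the preimage `U` of `D(t_A)`
  let UA : TA.Opens := tιA ⁻¹ᵁ DA
  have hisoρ : IsIso (ρ ∣_ ψk ⁻¹ᵁ UA) := by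
    have h := morphismRestrict_pullback_snd_of_morphismRestrict
      (P := MorphismProperty.isomorphisms Scheme) πA ψk UA
      ((MorphismProperty.isomorphisms.iff _).mpr hisoπ)
    exact (MorphismProperty.isomorphisms.iff _).mp h
  -- `U` is non-empty (a prime of `((MvPolynomial (Fin n) A) ⧸ J) ⊗ k` avoiding the non-nilpotent `t_A ⊗ 1`), hence dense
  have hdense : Dense ((ψk ⁻¹ᵁ UA : Tφ.Opens) : Set Tφ) := by
    haveI : IsIntegral Tφ := hint
    apply dense_of_isOpen_of_nonempty
    have hnn : ¬ IsNilpotent ((Ideal.Quotient.mk J tA) ⊗ₜ[A] (1 : k) :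
        ((MvPolynomial (Fin n) A) ⧸ J) ⊗[A] k) := hb₂ k ha₂
    have hne : PrimeSpectrum.basicOpen ((Ideal.Quotient.mk J tA) ⊗ₜ[A] (1 : k) :
        ((MvPolynomial (Fin n) A) ⧸ J) ⊗[A] k) ≠ ⊥ :=
      fun hb => hnn ((PrimeSpectrum.basicOpen_eq_bot_iff _).mp hb)
    obtain ⟨q, hq⟩ := Set.nonempty_iff_ne_empty.mpr
      (fun hemp => hne (TopologicalSpace.Opens.coe_eq_empty.mp hemp))
    let e := pullbackSpecIso A ((MvPolynomial (Fin n) A) ⧸ J) k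
    let q' : Spec (CommRingCat.of (((MvPolynomial (Fin n) A) ⧸ J) ⊗[A] k)) := q
    refine ⟨e.inv q', ?_⟩
    change ψk (e.inv q') ∈ UA
    have hψq : ψk (e.inv q') = Spec.map (CommRingCat.ofHom
        (algebraMap ((MvPolynomial (Fin n) A) ⧸ J) (((MvPolynomial (Fin n) A) ⧸ J) ⊗[A] k))) q' := by
      rw [← Scheme.Hom.comp_apply]
      exact congrArg (fun f => f.base q')
        (pullbackSpecIso_inv_fst' A ((MvPolynomial (Fin n) A) ⧸ J) k)
    rw [hψq]
    -- `tιA (Spec.map g q') ∈ D(t_A)` iff `(g ∘ mk) t_A = t_A ⊗ 1 ∉ q`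
    show tιA (Spec.map (CommRingCat.ofHom
        (algebraMap ((MvPolynomial (Fin n) A) ⧸ J) (((MvPolynomial (Fin n) A) ⧸ J) ⊗[A] k))) q') ∈ DA
    have htι : tιA = Spec.map (CommRingCat.ofHom (Ideal.Quotient.mk J)) := rfl
    rw [htι, Spec.map_apply, Spec.map_apply]
    exact hq
  exact hasResolution_of_isIso_morphismRestrict ρ hregρ (ψk ⁻¹ᵁ UA) hdense hisoρ

end Model

end Literature.AlgebraicGeometry.Resolution

end
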